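import Mathlib
import HarnessLib
import Summits.ResolutionOfSingularities.ResolutionOfSingularities.Theorems.WildQuotientsWildQuotientResolutionS1aD4Move4
import Summits.ResolutionOfSingularities.ResolutionOfSingularities.Theorems.WildQuotientsWildQuotientResolutionS1aD4Move3Ring
import Summits.ResolutionOfSingularities.ResolutionOfSingularities.Theorems.WildQuotientsWildQuotientResolutionS1aD4Move3Cover
import Summits.ResolutionOfSingularities.ResolutionOfSingularities.Theorems.WildQuotientsWildQuotientResolutionS1aA1Move2Regular
import Summits.ResolutionOfSingularities.ResolutionOfSingularities.Theorems.WildQuotientsWildQuotientResolutionS1aFreeModelStep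
import Summits.ResolutionOfSingularities.ResolutionOfSingularities.Theorems.WildQuotientsWildQuotientResolutionS1aModelTools
import Summits.ResolutionOfSingularities.ResolutionOfSingularities.Theorems.WildQuotientsWildQuotientResolutionS1aKillFreeShots
import Summits.ResolutionOfSingularities.ResolutionOfSingularities.Theorems.WildQuotientsWildQuotientResolutionS1aD4LeafTools

/-!
# S1a — INSTANCE I-3 (D₄): the LEAF of the kill tree — from the exposed node of `[Y]₂` (output of `d4_move3`) to `KillsIn 1`

[OURS · L1 W4.5c · lead-1 g13; plan-1 RULING R-F15e (I-3 = `KillsIn 4 (initial)` on MT-D₄ v1.1, leaves upward), X-CERT v1.2-D4ROWS move 4, NOTES `D4 TREE OF RECORD`;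
pattern of ✓`…S1aA1KillLeaf`] — NOT statements of the manuscript; counted 0; AI-level work, weaker than expert review. Crux stmt-ResolutionOfSingularities-17941
`CyclicQuotientFourfolds`, line `s1a-logminvertex` v13 (`stub_reachLowerInFX`).
★★★ `GameFrame.GModel.d4_killsIn_one` — `M₃` carrying the output of ✓`d4_move3` over the FREE MODEL `Q = k[w, s, Y, X₁, Z, x₃][1/h_Q]` of the node of `[z′]`
(`h_Q = (∏ⱼ (ZX₁ + j(w − sX₁)Ys))^{a}·Z^{b}`; opaque fixed `t`, cover unit `V₀`, norm unit `N_X` with `s^p·N_X` of degree 0; rows of ✓`…S1aD4Move3Ring`): the residual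
chart `W₃ = [Y]₂` with its pinned node, the ratio section, pulled-back sections with values in `𝒥₁`, an atlas with `F ⊆ W₃` ⇒ `KillsIn 1 M₃`, by the free
model `k[s₃, W′, s, Y′, X₁, Z, x₃][1/h₃]` of `Γ(W₃)` (✓`exists_chartFreeModelEquiv`), the move-4 rows, degrees (cover units `c₀², c₀⁻², N_X^{2dd₃}`), K1′ for the
variables `(s₃, W′, s)`, and ✓`d4_move4`.
-/

set_option linter.dupNamespace false

noncomputable section

open CategoryTheory Limits AlgebraicGeometry TopologicalSpace Topology Opposite
open Literature.AlgebraicGeometry.Resolution Literature.AlgebraicGeometry.RelativeSpec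
open scoped LaurentPolynomial
open MvPolynomial
open Summit.ResolutionOfSingularities.ResolutionOfSingularities.Theorems.WildQuotientResolution.S1 Summit.ResolutionOfSingularities.ResolutionOfSingularities.Theorems.WildQuotientResolution.S1.NodeAtlas Summit.ResolutionOfSingularities.ResolutionOfSingularities.Theorems.WildQuotientResolution.S1.CoarseChart
open Summit.ResolutionOfSingularities.ResolutionOfSingularities.Theorems.WildQuotientResolution.S1.ProducerStep Summit.ResolutionOfSingularities.ResolutionOfSingularities.Theorems.WildQuotientResolution.S1.NpFrame Summit.ResolutionOfSingularities.ResolutionOfSingularities.Theorems.WildQuotientResolution.S1.GoodCharts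
open Summit.ResolutionOfSingularities.ResolutionOfSingularities.Theorems.WildQuotientResolution.S1.BlowupCharts Summit.ResolutionOfSingularities.ResolutionOfSingularities.Theorems.WildQuotientResolution.S1.KillCert Summit.ResolutionOfSingularities.ResolutionOfSingularities.Theorems.WildQuotientResolution.S1.ReesBigrading
open Summit.ResolutionOfSingularities.ResolutionOfSingularities.Theorems.WildQuotientResolution.S1.NodeTransport Summit.ResolutionOfSingularities.ResolutionOfSingularities.Theorems.WildQuotientResolution.S1.CobordantTransport Summit.ResolutionOfSingularities.ResolutionOfSingularities.Theorems.WildQuotientResolution.S1.FreeModel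
open Summit.ResolutionOfSingularities.ResolutionOfSingularities.Theorems.WildQuotientResolution.S1.ModelNode

namespace Summit.ResolutionOfSingularities.ResolutionOfSingularities.Theorems.WildQuotientResolution.S1.GameFrame.GModel

variable {p : ℕ} {X' X₁ : Scheme.{0}} {q : X' ⟶ X₁} {G : Type} [Group G] {ρ : G →* Aut X'} {g₀ : G}

set_option maxHeartbeats 16000000 in
set_option synthInstance.maxHeartbeats 400000 in
/-- ★★★ **THE LEAF OF THE D₄ KILL TREE**: from the exposed node of `[Y]₂` over the free model `Q` of the node of `[z′]` to `KillsIn 1`. See the module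
docstring. [OURS · L1 W4.5c · R-F15e I-3; NOT a statement of the manuscript] -/
theorem d4_killsIn_one [Finite G] [NeZero p] (hp : p.Prime) (hG : ∀ g : G, g ∈ Subgroup.zpowers g₀) {k : Type} [Field k] [CharP k p]
    (M₃ : GModel p q G ρ g₀) [M₃.V.IsSeparated]
    -- the free model `Q = k[w, s, Y, X₁, Z, x₃][1/h_Q]` of the node of `[z′]`
    (hQ : MvPolynomial (Option (Option (Fin 4))) k) (a b d : ℕ) (ha : 0 < a) (hb : 0 < b) (hd : 0 < d)
    (hhQ : hQ = (∏ j : ZMod p, (X (some (some 2)) * X (some (some 1)) + C (j.val : k) * ((X none - X (some none) * X (some (some 1))) * X (some (some 0)) * X (some none)))) ^ a * X (some (some 2)) ^ b)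
    (w s Y X₁ Z x₃ t V₀ NX : Localization.Away hQ)
    (hw : w = algebraMap (MvPolynomial (Option (Option (Fin 4))) k) (Localization.Away hQ) (X none))
    (hs : s = algebraMap (MvPolynomial (Option (Option (Fin 4))) k) (Localization.Away hQ) (X (some none)))
    (hY : Y = algebraMap (MvPolynomial (Option (Option (Fin 4))) k) (Localization.Away hQ) (X (some (some 0))))
    (hX₁ : X₁ = algebraMap (MvPolynomial (Option (Option (Fin 4))) k) (Localization.Away hQ) (X (some (some 1))))
    (hZ : Z = algebraMap (MvPolynomial (Option (Option (Fin 4))) k) (Localization.Away hQ) (X (some (some 2))))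
    (hx₃ : x₃ = algebraMap (MvPolynomial (Option (Option (Fin 4))) k) (Localization.Away hQ) (X (some (some 3))))
    {m : ℕ} {r : Fin m → ℕ} (𝒜Q : (Π j : Fin m, ZMod (r j)) → AddSubgroup (Localization.Away hQ)) [GradedRing 𝒜Q] (θY θs θt : Π j : Fin m, ZMod (r j))
    (τQ : Localization.Away hQ ≃+* Localization.Away hQ)
    (rt : τQ t = t) (rs : τQ s = s) (rY : τQ Y = Y) (rZ : τQ Z = Z) (rX₁ : τQ X₁ = X₁ + s * t * Y) (rx₃ : τQ x₃ = x₃ - s * t * X₁ * Z * w)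
    (rw' : τQ w = w + s ^ 2 * t * Y) (rN : τQ NX = NX)
    (rfix : ∀ g' ∈ (({IsLocalization.Away.invSelf hQ} : Set (Localization.Away hQ)) ∪ Set.range (algebraMap k (Localization.Away hQ))), τQ g' = g')
    (rh : τQ (algebraMap (MvPolynomial (Option (Option (Fin 4))) k) (Localization.Away hQ) hQ) = algebraMap (MvPolynomial (Option (Option (Fin 4))) k) (Localization.Away hQ) hQ)
    (hσpQ : ∀ x : Localization.Away hQ, (⇑τQ)^[p] x = x)
    (hV₀u : IsUnit V₀) (hNu : IsUnit NX)
    (dgs : s ∈ 𝒜Q θs) (dgt : t ∈ 𝒜Q θt) (dgN : s ^ p * NX ∈ 𝒜Q 0) (hR1 : θY + 2 • θs + θt = 0)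
    -- the output of move 3 on `M₃`
    (d₃ : ℕ) (hd₃ : 0 < d₃) (W₃ : M₃.act.StableAffineOpens) (hW₃aff : IsAffineOpen W₃.1)
    (hf₃ : ∀ i, (![Y, w] : Fin 2 → Localization.Away hQ) i ∈ 𝒜Q ((![θY, 0] : Fin 2 → Π j : Fin m, ZMod (r j)) i))
    (hσJ₃ : ∀ n : ℕ, ((weightedFiltration (![Y, w] : Fin 2 → Localization.Away hQ) ![2, 1]).ideal n).map (τQ : Localization.Away hQ →+* Localization.Away hQ) ≤ (weightedFiltration (![Y, w] : Fin 2 → Localization.Away hQ) ![2, 1]).ideal n)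
    (y₀ : ↥(𝒜Q 0)) (hy₀v : (y₀ : Localization.Away hQ) = (Y ^ (d * p) * V₀) ^ d₃)
    (hy₀ : y₀ ∈ (traceFiltration 𝒜Q (![Y, w] : Fin 2 → Localization.Away hQ) ![2, 1]).ideal (d₃ * (d * (2 * p)))) (hσy₀ : τQ (y₀ : Localization.Away hQ) = y₀)
    (c₁ : ↥(cobordantAlgebra (![Y, w] : Fin 2 → Localization.Away hQ) ![2, 1]))
    (hc₁ : (c₁ : (Localization.Away hQ)[T;T⁻¹]) = LaurentPolynomial.C ((∏ i : ZMod p, (w + (i.val : Localization.Away hQ) * (s ^ 2 * t * Y))) ^ (2 * d * d₃)) * LaurentPolynomial.T (((d₃ * (d * (2 * p)) : ℕ)) : ℤ))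
    (E₃ : letI := chartNodeGradedRing r 𝒜Q (![Y, w] : Fin 2 → Localization.Away hQ) ![2, 1] hf₃ (d₃ * (d * (2 * p))) y₀ hy₀; Γ(M₃.V, W₃.1) ≃+* ↥(chartNodeGrading r 𝒜Q (![Y, w] : Fin 2 → Localization.Away hQ) ![2, 1] hf₃ (d₃ * (d * (2 * p))) y₀ hy₀ 0))
    (htame₃ : letI := chartNodeGradedRing r 𝒜Q (![Y, w] : Fin 2 → Localization.Away hQ) ![2, 1] hf₃ (d₃ * (d * (2 * p))) y₀ hy₀; IsTameNode p (ChartRing 𝒜Q (![Y, w] : Fin 2 → Localization.Away hQ) ![2, 1] (d₃ * (d * (2 * p))) y₀ hy₀) (chartNodeGrading r 𝒜Q (![Y, w] : Fin 2 → Localization.Away hQ) ![2, 1] hf₃ (d₃ * (d * (2 * p))) y₀ hy₀) (sigmaChart 𝒜Q (![Y, w] : Fin 2 → Localization.Away hQ) ![2, 1] (d₃ * (d * (2 * p))) y₀ hy₀ τQ hσJ₃ hp.pos hσpQ hσy₀))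
    (hE₃ : letI := chartNodeGradedRing r 𝒜Q (![Y, w] : Fin 2 → Localization.Away hQ) ![2, 1] hf₃ (d₃ * (d * (2 * p))) y₀ hy₀; ∀ t' : Γ(M₃.V, W₃.1), ((E₃ ((M₃.act.aut g₀⁻¹).hom.appLE W₃.1 W₃.1 (W₃.2.1 g₀⁻¹).ge t') : ↥(chartNodeGrading r 𝒜Q (![Y, w] : Fin 2 → Localization.Away hQ) ![2, 1] hf₃ (d₃ * (d * (2 * p))) y₀ hy₀ 0)) : ChartRing 𝒜Q (![Y, w] : Fin 2 → Localization.Away hQ) ![2, 1] (d₃ * (d * (2 * p))) y₀ hy₀) = sigmaChart 𝒜Q (![Y, w] : Fin 2 → Localization.Away hQ) ![2, 1] (d₃ * (d * (2 * p))) y₀ hy₀ τQ hσJ₃ hp.pos hσpQ hσy₀ ((E₃ t' : ↥(chartNodeGrading r 𝒜Q (![Y, w] : Fin 2 → Localization.Away hQ) ![2, 1] hf₃ (d₃ * (d * (2 * p))) y₀ hy₀ 0)) : ChartRing 𝒜Q (![Y, w] : Fin 2 → Localization.Away hQ) ![2, 1] (d₃ * (d * (2 * p))) y₀ hy₀))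
    {ι : Type} (U : ι → M₃.V.Opens) (W₃' : M₃.V.Opens) (hcov : ∀ x : M₃.V, x ∈ W₃.1 ∨ x ∈ W₃' ∨ ∃ i, x ∈ U i)
    (u₃ : Γ(M₃.V, W₃.1))
    (hu₃v : letI := chartNodeGradedRing r 𝒜Q (![Y, w] : Fin 2 → Localization.Away hQ) ![2, 1] hf₃ (d₃ * (d * (2 * p))) y₀ hy₀; ((E₃ u₃ : ↥(chartNodeGrading r 𝒜Q (![Y, w] : Fin 2 → Localization.Away hQ) ![2, 1] hf₃ (d₃ * (d * (2 * p))) y₀ hy₀ 0)) : ChartRing 𝒜Q (![Y, w] : Fin 2 → Localization.Away hQ) ![2, 1] (d₃ * (d * (2 * p))) y₀ hy₀) = algebraMap _ (ChartRing 𝒜Q (![Y, w] : Fin 2 → Localization.Away hQ) ![2, 1] (d₃ * (d * (2 * p))) y₀ hy₀) c₁ * IsLocalization.Away.invSelf (coverElement 𝒜Q (![Y, w] : Fin 2 → Localization.Away hQ) ![2, 1] (d₃ * (d * (2 * p))) y₀ hy₀))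
    (hu₃U : ∀ v ∈ W₃.1, v ∈ W₃' → v ∈ M₃.V.basicOpen u₃)
    (uU : ι → Γ(M₃.V, W₃.1)) (xU : ι → ↥(𝒜Q 0))
    (hxU : ∀ i, (xU i : Localization.Away hQ) ∈ (weightedFiltration (![Y, w] : Fin 2 → Localization.Away hQ) ![2, 1]).ideal 1)
    (huUv : letI := chartNodeGradedRing r 𝒜Q (![Y, w] : Fin 2 → Localization.Away hQ) ![2, 1] hf₃ (d₃ * (d * (2 * p))) y₀ hy₀; ∀ i, ((E₃ (uU i) : ↥(chartNodeGrading r 𝒜Q (![Y, w] : Fin 2 → Localization.Away hQ) ![2, 1] hf₃ (d₃ * (d * (2 * p))) y₀ hy₀ 0)) : ChartRing 𝒜Q (![Y, w] : Fin 2 → Localization.Away hQ) ![2, 1] (d₃ * (d * (2 * p))) y₀ hy₀) = toChartRing 𝒜Q (![Y, w] : Fin 2 → Localization.Away hQ) ![2, 1] (d₃ * (d * (2 * p))) y₀ hy₀ (xU i))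
    (huUU : ∀ i, ∀ v ∈ W₃.1, v ∈ U i → v ∈ M₃.V.basicOpen (uU i))
    (𝔄₃ : NodeAtlasData p M₃.act g₀) (hF₃ : 𝔄₃.fLocus ⊆ (W₃.1 : Set M₃.V)) : KillsIn 1 M₃ := by
  classical
  letI instN := chartNodeGradedRing r 𝒜Q (![Y, w] : Fin 2 → Localization.Away hQ) ![2, 1] hf₃ (d₃ * (d * (2 * p))) y₀ hy₀
  have hp1 : p ≠ 1 := hp.one_lt.ne'
  have hdp : 0 < d * p := Nat.mul_pos hd hp.pos
  have hK : 0 < d₃ * (d * (2 * p)) := Nat.mul_pos hd₃ (Nat.mul_pos hd (Nat.mul_pos two_pos hp.pos))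
  have hv : Function.Injective (![some (some 0), none] : Fin 2 → Option (Option (Fin 4))) := by
    intro i j hij; fin_cases i <;> fin_cases j <;> first | rfl | exact absurd hij (by decide)
  have hvW : ∀ i, (fun o : Option (Option (Fin 4)) => Option.elim o 1 (fun o' => Option.elim o' 0 ![2, 0, 0, 0])) ((![some (some 0), none] : Fin 2 → Option (Option (Fin 4))) i) = (![2, 1] : Fin 2 → ℕ) i := by
    intro i; fin_cases i <;> rfl
  have hW : ∀ l : Option (Option (Fin 4)), (fun o : Option (Option (Fin 4)) => Option.elim o 1 (fun o' => Option.elim o' 0 ![2, 0, 0, 0])) l = 0 ∨ ∃ i, (![some (some 0), none] : Fin 2 → Option (Option (Fin 4))) i = l := by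
    rintro (_ | _ | l)
    · exact Or.inr ⟨1, rfl⟩
    · exact Or.inl rfl
    · fin_cases l
      · exact Or.inr ⟨0, rfl⟩
      all_goals exact Or.inl rfl
  have hf₃' : ∀ i, (![Y, w] : Fin 2 → Localization.Away hQ) i = algebraMap (MvPolynomial (Option (Option (Fin 4))) k) (Localization.Away hQ) (X ((![some (some 0), none] : Fin 2 → Option (Option (Fin 4))) i)) := by
    intro i; fin_cases i
    · exact hY
    · exact hw
  -- the cover element of `W₃` in `R₃`, as a product of generators
  have hc0R : coverElement 𝒜Q (![Y, w] : Fin 2 → Localization.Away hQ) ![2, 1] (d₃ * (d * (2 * p))) y₀ hy₀ = cobordantAlgebra.u' _ ![2, 1] 0 ^ (d * p * d₃) * algebraMap (Localization.Away hQ) _ (V₀ ^ d₃) := by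
    refine Subtype.ext ?_
    rw [coe_coverElement, hy₀v, MulMemClass.coe_mul, SubmonoidClass.coe_pow, cobordantAlgebra.coe_u', cobordantAlgebra.coe_algebraMap]
    change _ = (LaurentPolynomial.C Y * LaurentPolynomial.T ((2 : ℕ) : ℤ)) ^ (d * p * d₃) * LaurentPolynomial.C (V₀ ^ d₃)
    rw [mul_pow (LaurentPolynomial.C Y), ← map_pow, LaurentPolynomial.T_pow, mul_right_comm, ← map_mul, show ((d * p * d₃ : ℕ) : ℤ) * ((2 : ℕ) : ℤ) = ((d₃ * (d * (2 * p)) : ℕ) : ℤ) by push_cast; ring]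
    congr 2
    rw [mul_pow, ← pow_mul]
  have hz : ∀ Ψ : ↥(cobordantAlgebra (![Y, w] : Fin 2 → Localization.Away hQ) ![2, 1]) ≃+* Localization.Away (cobordantAlgebra.subst k (fun o : Option (Option (Fin 4)) => Option.elim o 1 (fun o' => Option.elim o' 0 ![2, 0, 0, 0])) hQ), (∀ a : MvPolynomial (Option (Option (Fin 4))) k, Ψ (algebraMap (Localization.Away hQ) _ (algebraMap (MvPolynomial (Option (Option (Fin 4))) k) (Localization.Away hQ) a)) = algebraMap (MvPolynomial (Option (Option (Option (Fin 4)))) k) _ (cobordantAlgebra.subst k (fun o : Option (Option (Fin 4)) => Option.elim o 1 (fun o' => Option.elim o' 0 ![2, 0, 0, 0])) a)) →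
      Ψ (cobordantAlgebra.s _ ![2, 1]) = algebraMap (MvPolynomial (Option (Option (Option (Fin 4)))) k) _ (X none) → (∀ i, Ψ (cobordantAlgebra.u' _ ![2, 1] i) = algebraMap (MvPolynomial (Option (Option (Option (Fin 4)))) k) _ (X (some ((![some (some 0), none] : Fin 2 → Option (Option (Fin 4))) i)))) → Associated (algebraMap (MvPolynomial (Option (Option (Option (Fin 4)))) k) (Localization.Away (cobordantAlgebra.subst k (fun o : Option (Option (Fin 4)) => Option.elim o 1 (fun o' => Option.elim o' 0 ![2, 0, 0, 0])) hQ)) (X (some (some (some 0))) ^ (d * p * d₃)))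
        (Ψ (coverElement 𝒜Q (![Y, w] : Fin 2 → Localization.Away hQ) ![2, 1] (d₃ * (d * (2 * p))) y₀ hy₀)) := by
    intro Ψ _ _ hu
    have hU : IsUnit (Ψ (algebraMap (Localization.Away hQ) _ (V₀ ^ d₃))) := ((hV₀u.pow d₃).map _).map Ψ
    refine ⟨hU.unit, ?_⟩
    rw [IsUnit.unit_spec, hc0R]
    simp only [map_pow, map_mul, hu 0, Matrix.cons_val_zero]
  obtain ⟨Φ₃, hΦa, hΦS, hΦu⟩ := exists_chartFreeModelEquiv k (fun o : Option (Option (Fin 4)) => Option.elim o 1 (fun o' => Option.elim o' 0 ![2, 0, 0, 0])) hQ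
    (![some (some 0), none]) ![2, 1] hvW hW _ hf₃' 𝒜Q (d₃ * (d * (2 * p))) y₀ hy₀ (X (some (some (some 0))) ^ (d * p * d₃)) hz
  letI instM := mapGradedRing (chartNodeGrading r 𝒜Q (![Y, w] : Fin 2 → Localization.Away hQ) ![2, 1] hf₃ (d₃ * (d * (2 * p))) y₀ hy₀) Φ₃
  have hsub : ∀ o : Option (Option (Fin 4)), cobordantAlgebra.subst k (fun o : Option (Option (Fin 4)) => Option.elim o 1 (fun o' => Option.elim o' 0 ![2, 0, 0, 0])) (X o) = X none ^ ((fun o : Option (Option (Fin 4)) => Option.elim o 1 (fun o' => Option.elim o' 0 ![2, 0, 0, 0])) o) * X (some o) := fun o => by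
    rw [cobordantAlgebra.subst, MvPolynomial.eval₂Hom_X']
  have hΦw : Φ₃ (algebraMap ↥(cobordantAlgebra (![Y, w] : Fin 2 → Localization.Away hQ) ![2, 1]) (ChartRing 𝒜Q (![Y, w] : Fin 2 → Localization.Away hQ) ![2, 1] (d₃ * (d * (2 * p))) y₀ hy₀) (algebraMap (Localization.Away hQ) _ (algebraMap (MvPolynomial (Option (Option (Fin 4))) k) (Localization.Away hQ) (X none)))) = algebraMap (MvPolynomial (Option (Option (Option (Fin 4)))) k) _ (X none) * algebraMap (MvPolynomial (Option (Option (Option (Fin 4)))) k) _ (X (some none)) := by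
    rw [hΦa, hsub]; change algebraMap _ _ (X none ^ 1 * _) = _; rw [pow_one, map_mul]
  have hΦs : Φ₃ (algebraMap ↥(cobordantAlgebra (![Y, w] : Fin 2 → Localization.Away hQ) ![2, 1]) (ChartRing 𝒜Q (![Y, w] : Fin 2 → Localization.Away hQ) ![2, 1] (d₃ * (d * (2 * p))) y₀ hy₀) (algebraMap (Localization.Away hQ) _ (algebraMap (MvPolynomial (Option (Option (Fin 4))) k) (Localization.Away hQ) (X (some none))))) = algebraMap (MvPolynomial (Option (Option (Option (Fin 4)))) k) _ (X (some (some none))) := by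
    rw [hΦa, hsub]; change algebraMap _ _ (X none ^ 0 * _) = _; rw [pow_zero, one_mul]
  have hΦY : Φ₃ (algebraMap ↥(cobordantAlgebra (![Y, w] : Fin 2 → Localization.Away hQ) ![2, 1]) (ChartRing 𝒜Q (![Y, w] : Fin 2 → Localization.Away hQ) ![2, 1] (d₃ * (d * (2 * p))) y₀ hy₀) (algebraMap (Localization.Away hQ) _ (algebraMap (MvPolynomial (Option (Option (Fin 4))) k) (Localization.Away hQ) (X (some (some 0)))))) = algebraMap (MvPolynomial (Option (Option (Option (Fin 4)))) k) _ (X none) ^ 2 * algebraMap (MvPolynomial (Option (Option (Option (Fin 4)))) k) _ (X (some (some (some 0)))) := by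
    rw [hΦa, hsub]; change algebraMap _ _ (X none ^ 2 * _) = _; rw [map_mul, map_pow]
  have hΦX₁ : Φ₃ (algebraMap ↥(cobordantAlgebra (![Y, w] : Fin 2 → Localization.Away hQ) ![2, 1]) (ChartRing 𝒜Q (![Y, w] : Fin 2 → Localization.Away hQ) ![2, 1] (d₃ * (d * (2 * p))) y₀ hy₀) (algebraMap (Localization.Away hQ) _ (algebraMap (MvPolynomial (Option (Option (Fin 4))) k) (Localization.Away hQ) (X (some (some 1)))))) = algebraMap (MvPolynomial (Option (Option (Option (Fin 4)))) k) _ (X (some (some (some 1)))) := by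
    rw [hΦa, hsub]; change algebraMap _ _ (X none ^ 0 * _) = _; rw [pow_zero, one_mul]
  have hΦZ : Φ₃ (algebraMap ↥(cobordantAlgebra (![Y, w] : Fin 2 → Localization.Away hQ) ![2, 1]) (ChartRing 𝒜Q (![Y, w] : Fin 2 → Localization.Away hQ) ![2, 1] (d₃ * (d * (2 * p))) y₀ hy₀) (algebraMap (Localization.Away hQ) _ (algebraMap (MvPolynomial (Option (Option (Fin 4))) k) (Localization.Away hQ) (X (some (some 2)))))) = algebraMap (MvPolynomial (Option (Option (Option (Fin 4)))) k) _ (X (some (some (some 2)))) := by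
    rw [hΦa, hsub]; change algebraMap _ _ (X none ^ 0 * _) = _; rw [pow_zero, one_mul]
  have hΦx₃ : Φ₃ (algebraMap ↥(cobordantAlgebra (![Y, w] : Fin 2 → Localization.Away hQ) ![2, 1]) (ChartRing 𝒜Q (![Y, w] : Fin 2 → Localization.Away hQ) ![2, 1] (d₃ * (d * (2 * p))) y₀ hy₀) (algebraMap (Localization.Away hQ) _ (algebraMap (MvPolynomial (Option (Option (Fin 4))) k) (Localization.Away hQ) (X (some (some 3)))))) = algebraMap (MvPolynomial (Option (Option (Option (Fin 4)))) k) _ (X (some (some (some 3)))) := by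
    rw [hΦa, hsub]; change algebraMap _ _ (X none ^ 0 * _) = _; rw [pow_zero, one_mul]
  have hΦC : ∀ a : k, Φ₃ (algebraMap ↥(cobordantAlgebra (![Y, w] : Fin 2 → Localization.Away hQ) ![2, 1]) (ChartRing 𝒜Q (![Y, w] : Fin 2 → Localization.Away hQ) ![2, 1] (d₃ * (d * (2 * p))) y₀ hy₀) (algebraMap (Localization.Away hQ) _ (algebraMap (MvPolynomial (Option (Option (Fin 4))) k) (Localization.Away hQ) (C a)))) = algebraMap (MvPolynomial (Option (Option (Option (Fin 4)))) k) _ (C a) := fun a => by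
    rw [hΦa, cobordantAlgebra.subst, MvPolynomial.eval₂Hom_C]
  have hΦwv := hΦw
  rw [← hw] at hΦwv
  have hΦYv := hΦY
  rw [← hY] at hΦYv
  have hΦY' := hΦu 0
  have hΦW' := hΦu 1
  simp only [Matrix.cons_val_zero, Matrix.cons_val_one] at hΦY' hΦW'
  -- opaque images: `t′, V₀′, N′, η′`
  set t' := Φ₃ (algebraMap ↥(cobordantAlgebra (![Y, w] : Fin 2 → Localization.Away hQ) ![2, 1]) (ChartRing 𝒜Q (![Y, w] : Fin 2 → Localization.Away hQ) ![2, 1] (d₃ * (d * (2 * p))) y₀ hy₀) (algebraMap (Localization.Away hQ) _ t)) with ht'def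
  set N' := Φ₃ (algebraMap ↥(cobordantAlgebra (![Y, w] : Fin 2 → Localization.Away hQ) ![2, 1]) (ChartRing 𝒜Q (![Y, w] : Fin 2 → Localization.Away hQ) ![2, 1] (d₃ * (d * (2 * p))) y₀ hy₀) (algebraMap (Localization.Away hQ) _ NX)) with hN'def
  set η' := Φ₃ (algebraMap ↥(cobordantAlgebra (![Y, w] : Fin 2 → Localization.Away hQ) ![2, 1]) (ChartRing 𝒜Q (![Y, w] : Fin 2 → Localization.Away hQ) ![2, 1] (d₃ * (d * (2 * p))) y₀ hy₀) (algebraMap (Localization.Away hQ) _ (IsLocalization.Away.invSelf hQ))) with hη'def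
  set c₀' := Φ₃ (algebraMap ↥(cobordantAlgebra (![Y, w] : Fin 2 → Localization.Away hQ) ![2, 1]) (ChartRing 𝒜Q (![Y, w] : Fin 2 → Localization.Away hQ) ![2, 1] (d₃ * (d * (2 * p))) y₀ hy₀) (coverElement 𝒜Q (![Y, w] : Fin 2 → Localization.Away hQ) ![2, 1] (d₃ * (d * (2 * p))) y₀ hy₀)) with hc₀'def
  set κ' := Φ₃ (IsLocalization.Away.invSelf (coverElement 𝒜Q (![Y, w] : Fin 2 → Localization.Away hQ) ![2, 1] (d₃ * (d * (2 * p))) y₀ hy₀)) with hκ'def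
  have hcκ : c₀' * κ' = 1 := by rw [hc₀'def, hκ'def, ← map_mul, IsLocalization.Away.mul_invSelf, map_one]
  have hτ : ∀ b, conj Φ₃ (sigmaChart 𝒜Q (![Y, w] : Fin 2 → Localization.Away hQ) ![2, 1] (d₃ * (d * (2 * p))) y₀ hy₀ τQ hσJ₃ hp.pos hσpQ hσy₀) (Φ₃ b) = Φ₃ (sigmaChart 𝒜Q (![Y, w] : Fin 2 → Localization.Away hQ) ![2, 1] (d₃ * (d * (2 * p))) y₀ hy₀ τQ hσJ₃ hp.pos hσpQ hσy₀ b) := fun b => conj_apply_map Φ₃ _ b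
  -- fixed images of fixed elements of `Q`
  have hσfixQ : ∀ x : Localization.Away hQ, τQ x = x → conj Φ₃ (sigmaChart 𝒜Q (![Y, w] : Fin 2 → Localization.Away hQ) ![2, 1] (d₃ * (d * (2 * p))) y₀ hy₀ τQ hσJ₃ hp.pos hσpQ hσy₀)
        (Φ₃ (algebraMap ↥(cobordantAlgebra (![Y, w] : Fin 2 → Localization.Away hQ) ![2, 1]) (ChartRing 𝒜Q (![Y, w] : Fin 2 → Localization.Away hQ) ![2, 1] (d₃ * (d * (2 * p))) y₀ hy₀) (algebraMap (Localization.Away hQ) _ x))) = Φ₃ (algebraMap ↥(cobordantAlgebra (![Y, w] : Fin 2 → Localization.Away hQ) ![2, 1]) (ChartRing 𝒜Q (![Y, w] : Fin 2 → Localization.Away hQ) ![2, 1] (d₃ * (d * (2 * p))) y₀ hy₀) (algebraMap (Localization.Away hQ) _ x)) := by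
    intro x hx
    rw [hτ]; rw [sigmaChart_algebraMap, sigmaR_algebraMap, hx]
  have hσs₃ : conj Φ₃ (sigmaChart 𝒜Q (![Y, w] : Fin 2 → Localization.Away hQ) ![2, 1] (d₃ * (d * (2 * p))) y₀ hy₀ τQ hσJ₃ hp.pos hσpQ hσy₀)
      (algebraMap (MvPolynomial (Option (Option (Option (Fin 4)))) k) _ (X none)) = algebraMap (MvPolynomial (Option (Option (Option (Fin 4)))) k) _ (X none) := by
    rw [← hΦS, hτ]; rw [sigmaChart_algebraMap, sigmaR_s]
  have hσY' : conj Φ₃ (sigmaChart 𝒜Q (![Y, w] : Fin 2 → Localization.Away hQ) ![2, 1] (d₃ * (d * (2 * p))) y₀ hy₀ τQ hσJ₃ hp.pos hσpQ hσy₀)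
      (algebraMap (MvPolynomial (Option (Option (Option (Fin 4)))) k) _ (X (some (some (some 0))))) = algebraMap (MvPolynomial (Option (Option (Option (Fin 4)))) k) _ (X (some (some (some 0)))) := by
    rw [← hΦY', hτ]; rw [sigmaChart_algebraMap]
    congr 2
    refine Subtype.ext ?_
    rw [coe_sigmaR, cobordantAlgebra.coe_u', sigmaT_C_mul_T]
    change LaurentPolynomial.C (τQ Y) * _ = _
    rw [rY]
    rfl
  have hσs : conj Φ₃ (sigmaChart 𝒜Q (![Y, w] : Fin 2 → Localization.Away hQ) ![2, 1] (d₃ * (d * (2 * p))) y₀ hy₀ τQ hσJ₃ hp.pos hσpQ hσy₀)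
      (algebraMap (MvPolynomial (Option (Option (Option (Fin 4)))) k) _ (X (some (some none)))) = algebraMap (MvPolynomial (Option (Option (Option (Fin 4)))) k) _ (X (some (some none))) := by
    rw [← hΦs, ← hs]; exact hσfixQ s rs
  have hσZ : conj Φ₃ (sigmaChart 𝒜Q (![Y, w] : Fin 2 → Localization.Away hQ) ![2, 1] (d₃ * (d * (2 * p))) y₀ hy₀ τQ hσJ₃ hp.pos hσpQ hσy₀)
      (algebraMap (MvPolynomial (Option (Option (Option (Fin 4)))) k) _ (X (some (some (some 2))))) = algebraMap (MvPolynomial (Option (Option (Option (Fin 4)))) k) _ (X (some (some (some 2)))) := by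
    rw [← hΦZ, ← hZ]; exact hσfixQ Z rZ
  have hσt : conj Φ₃ (sigmaChart 𝒜Q (![Y, w] : Fin 2 → Localization.Away hQ) ![2, 1] (d₃ * (d * (2 * p))) y₀ hy₀ τQ hσJ₃ hp.pos hσpQ hσy₀) t' = t' := hσfixQ t rt
  have hσN : conj Φ₃ (sigmaChart 𝒜Q (![Y, w] : Fin 2 → Localization.Away hQ) ![2, 1] (d₃ * (d * (2 * p))) y₀ hy₀ τQ hσJ₃ hp.pos hσpQ hσy₀) N' = N' := hσfixQ NX rN
  have hση : conj Φ₃ (sigmaChart 𝒜Q (![Y, w] : Fin 2 → Localization.Away hQ) ![2, 1] (d₃ * (d * (2 * p))) y₀ hy₀ τQ hσJ₃ hp.pos hσpQ hσy₀) η' = η' := hσfixQ _ (rfix _ (Set.mem_union_left _ (Set.mem_singleton _)))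
  have hσc₀ : conj Φ₃ (sigmaChart 𝒜Q (![Y, w] : Fin 2 → Localization.Away hQ) ![2, 1] (d₃ * (d * (2 * p))) y₀ hy₀ τQ hσJ₃ hp.pos hσpQ hσy₀) c₀' = c₀' := by
    rw [hc₀'def, hτ]; rw [sigmaChart_algebraMap, sigmaR_coverElement]; exact hσy₀
  have hσκ : conj Φ₃ (sigmaChart 𝒜Q (![Y, w] : Fin 2 → Localization.Away hQ) ![2, 1] (d₃ * (d * (2 * p))) y₀ hy₀ τQ hσJ₃ hp.pos hσpQ hσy₀) κ' = κ' := by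
    rw [hκ'def, hτ]; rw [sigmaChart_invSelf]
  have hσC : ∀ a : k, conj Φ₃ (sigmaChart 𝒜Q (![Y, w] : Fin 2 → Localization.Away hQ) ![2, 1] (d₃ * (d * (2 * p))) y₀ hy₀ τQ hσJ₃ hp.pos hσpQ hσy₀)
      (algebraMap (MvPolynomial (Option (Option (Option (Fin 4)))) k) _ (C a)) = algebraMap (MvPolynomial (Option (Option (Option (Fin 4)))) k) _ (C a) := by
    intro a
    rw [← hΦC]
    refine hσfixQ _ ?_
    rw [← MvPolynomial.algebraMap_eq, ← IsScalarTower.algebraMap_apply k (MvPolynomial (Option (Option (Fin 4))) k) (Localization.Away hQ) a]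
    exact rfix _ (Set.mem_union_right _ ⟨a, rfl⟩)
  -- the three moving rows, from the `R₃`-rows of `…S1aD4Move3Ring`
  have hσW' : conj Φ₃ (sigmaChart 𝒜Q (![Y, w] : Fin 2 → Localization.Away hQ) ![2, 1] (d₃ * (d * (2 * p))) y₀ hy₀ τQ hσJ₃ hp.pos hσpQ hσy₀)
      (algebraMap (MvPolynomial (Option (Option (Option (Fin 4)))) k) _ (X (some none))) = algebraMap (MvPolynomial (Option (Option (Option (Fin 4)))) k) _ (X (some none)) + algebraMap (MvPolynomial (Option (Option (Option (Fin 4)))) k) _ (X (some (some none))) ^ 2 * t' * algebraMap (MvPolynomial (Option (Option (Option (Fin 4)))) k) _ (X (some (some (some 0)))) * algebraMap (MvPolynomial (Option (Option (Option (Fin 4)))) k) _ (X none) := by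
    rw [← hΦW', hτ]; rw [sigmaChart_algebraMap, eq_add_of_sub_eq' (D4.d4m3_sigmaR_u'_one_sub τQ t s Y w rw' hp.pos hσpQ hσJ₃)]
    simp only [map_add, map_mul]
    rw [hΦW', hΦS, hΦY', ← ht'def, hs, hΦs]
    ring
  have hσX₁ : conj Φ₃ (sigmaChart 𝒜Q (![Y, w] : Fin 2 → Localization.Away hQ) ![2, 1] (d₃ * (d * (2 * p))) y₀ hy₀ τQ hσJ₃ hp.pos hσpQ hσy₀)
      (algebraMap (MvPolynomial (Option (Option (Option (Fin 4)))) k) _ (X (some (some (some 1))))) = algebraMap (MvPolynomial (Option (Option (Option (Fin 4)))) k) _ (X (some (some (some 1)))) + algebraMap (MvPolynomial (Option (Option (Option (Fin 4)))) k) _ (X (some (some none))) * t' * algebraMap (MvPolynomial (Option (Option (Option (Fin 4)))) k) _ (X (some (some (some 0)))) * algebraMap (MvPolynomial (Option (Option (Option (Fin 4)))) k) _ (X none) ^ 2 := by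
    rw [← hΦX₁, ← hX₁, hτ]; rw [sigmaChart_algebraMap, eq_add_of_sub_eq' (D4.d4m3_sigmaR_X₁_sub τQ t s Y X₁ w rX₁ hp.pos hσpQ hσJ₃)]
    simp only [map_add, map_mul]
    rw [hX₁, hΦX₁, hΦS, hΦY', ← ht'def, hs, hΦs]
    ring
  have hσx₃ : conj Φ₃ (sigmaChart 𝒜Q (![Y, w] : Fin 2 → Localization.Away hQ) ![2, 1] (d₃ * (d * (2 * p))) y₀ hy₀ τQ hσJ₃ hp.pos hσpQ hσy₀)
      (algebraMap (MvPolynomial (Option (Option (Option (Fin 4)))) k) _ (X (some (some (some 3))))) = algebraMap (MvPolynomial (Option (Option (Option (Fin 4)))) k) _ (X (some (some (some 3)))) -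
        algebraMap (MvPolynomial (Option (Option (Option (Fin 4)))) k) _ (X (some (some none))) * t' * algebraMap (MvPolynomial (Option (Option (Option (Fin 4)))) k) _ (X (some (some (some 1)))) * algebraMap (MvPolynomial (Option (Option (Option (Fin 4)))) k) _ (X (some (some (some 2)))) * algebraMap (MvPolynomial (Option (Option (Option (Fin 4)))) k) _ (X (some none)) * algebraMap (MvPolynomial (Option (Option (Option (Fin 4)))) k) _ (X none) := by
    have hrow : sigmaR τQ (![Y, w] : Fin 2 → Localization.Away hQ) ![2, 1] hσJ₃ hp.pos hσpQ (algebraMap (Localization.Away hQ) _ x₃) = algebraMap (Localization.Away hQ) _ x₃ - (algebraMap (Localization.Away hQ) _ (s * t) * cobordantAlgebra.s (![Y, w] : Fin 2 → Localization.Away hQ) ![2, 1]) * (algebraMap (Localization.Away hQ) _ X₁ * algebraMap (Localization.Away hQ) _ Z * cobordantAlgebra.u' (![Y, w] : Fin 2 → Localization.Away hQ) ![2, 1] 1) := by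
      linear_combination D4.d4m3_sigmaR_x₃_sub τQ t s Y X₁ Z x₃ w rx₃ hp.pos hσpQ hσJ₃
    rw [← hΦx₃, ← hx₃, hτ]; rw [sigmaChart_algebraMap, hrow]
    simp only [map_sub, map_mul]
    rw [hx₃, hΦx₃, hΦS, hΦW', ← ht'def, hs, hΦs, hX₁, hΦX₁, hZ, hΦZ]
    ring
  -- `σ` on the inverted element `h₃ = subst h_Q · Y′^{dpd₃}`
  have hσh' : conj Φ₃ (sigmaChart 𝒜Q (![Y, w] : Fin 2 → Localization.Away hQ) ![2, 1] (d₃ * (d * (2 * p))) y₀ hy₀ τQ hσJ₃ hp.pos hσpQ hσy₀)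
      (algebraMap (MvPolynomial (Option (Option (Option (Fin 4)))) k) _ (cobordantAlgebra.subst k (fun o : Option (Option (Fin 4)) => Option.elim o 1 (fun o' => Option.elim o' 0 ![2, 0, 0, 0])) hQ)) = algebraMap (MvPolynomial (Option (Option (Option (Fin 4)))) k) _ (cobordantAlgebra.subst k (fun o : Option (Option (Fin 4)) => Option.elim o 1 (fun o' => Option.elim o' 0 ![2, 0, 0, 0])) hQ) := by
    rw [← hΦa]; exact hσfixQ _ rh
  have hσh : conj Φ₃ (sigmaChart 𝒜Q (![Y, w] : Fin 2 → Localization.Away hQ) ![2, 1] (d₃ * (d * (2 * p))) y₀ hy₀ τQ hσJ₃ hp.pos hσpQ hσy₀)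
      (algebraMap (MvPolynomial (Option (Option (Option (Fin 4)))) k) _ (cobordantAlgebra.subst k (fun o : Option (Option (Fin 4)) => Option.elim o 1 (fun o' => Option.elim o' 0 ![2, 0, 0, 0])) hQ * X (some (some (some 0))) ^ (d * p * d₃))) = algebraMap (MvPolynomial (Option (Option (Option (Fin 4)))) k) _
        (cobordantAlgebra.subst k (fun o : Option (Option (Fin 4)) => Option.elim o 1 (fun o' => Option.elim o' 0 ![2, 0, 0, 0])) hQ * X (some (some (some 0))) ^ (d * p * d₃)) := by
    simp only [map_mul, map_pow, hσh', hσY']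
  have hσhinv : conj Φ₃ (sigmaChart 𝒜Q (![Y, w] : Fin 2 → Localization.Away hQ) ![2, 1] (d₃ * (d * (2 * p))) y₀ hy₀ τQ hσJ₃ hp.pos hσpQ hσy₀)
      (IsLocalization.Away.invSelf (cobordantAlgebra.subst k (fun o : Option (Option (Fin 4)) => Option.elim o 1 (fun o' => Option.elim o' 0 ![2, 0, 0, 0])) hQ * X (some (some (some 0))) ^ (d * p * d₃))) = IsLocalization.Away.invSelf (cobordantAlgebra.subst k (fun o : Option (Option (Fin 4)) => Option.elim o 1 (fun o' => Option.elim o' 0 ![2, 0, 0, 0])) hQ * X (some (some (some 0))) ^ (d * p * d₃)) :=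
    apply_eq_of_mul_eq_one _ (IsLocalization.Away.mul_invSelf _) hσh
  have hfix : ∀ g' ∈ (({IsLocalization.Away.invSelf (cobordantAlgebra.subst k (fun o : Option (Option (Fin 4)) => Option.elim o 1 (fun o' => Option.elim o' 0 ![2, 0, 0, 0])) hQ * X (some (some (some 0))) ^ (d * p * d₃)), c₀', κ', N', η'} : Set _) ∪ Set.range (algebraMap k _)), conj Φ₃ (sigmaChart 𝒜Q (![Y, w] : Fin 2 → Localization.Away hQ) ![2, 1] (d₃ * (d * (2 * p))) y₀ hy₀ τQ hσJ₃ hp.pos hσpQ hσy₀) g' = g' := by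
    rintro g' (hg | ⟨a, rfl⟩)
    · simp only [Set.mem_insert_iff, Set.mem_singleton_iff] at hg
      rcases hg with rfl | rfl | rfl | rfl | rfl
      exacts [hσhinv, hσc₀, hσκ, hσN, hση]
    · rw [IsScalarTower.algebraMap_apply k (MvPolynomial (Option (Option (Option (Fin 4)))) k) _ a, MvPolynomial.algebraMap_eq, hσC]
  have hgen := closure_range_X_invSelf_eq_top k (cobordantAlgebra.subst k (fun o : Option (Option (Fin 4)) => Option.elim o 1 (fun o' => Option.elim o' 0 ![2, 0, 0, 0])) hQ * X (some (some (some 0))) ^ (d * p * d₃))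
  have hgen' : Subring.closure (({t', algebraMap (MvPolynomial (Option (Option (Option (Fin 4)))) k) _ (X (some (some none))), algebraMap (MvPolynomial (Option (Option (Option (Fin 4)))) k) _ (X (some (some (some 0)))), algebraMap (MvPolynomial (Option (Option (Option (Fin 4)))) k) _ (X (some (some (some 1)))), algebraMap (MvPolynomial (Option (Option (Option (Fin 4)))) k) _ (X (some (some (some 2)))), algebraMap (MvPolynomial (Option (Option (Option (Fin 4)))) k) _ (X (some (some (some 3)))), algebraMap (MvPolynomial (Option (Option (Option (Fin 4)))) k) _ (X (some none)), algebraMap (MvPolynomial (Option (Option (Option (Fin 4)))) k) _ (X none)} : Set _) ∪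
      (({IsLocalization.Away.invSelf (cobordantAlgebra.subst k (fun o : Option (Option (Fin 4)) => Option.elim o 1 (fun o' => Option.elim o' 0 ![2, 0, 0, 0])) hQ * X (some (some (some 0))) ^ (d * p * d₃)), c₀', κ', N', η'} : Set _) ∪ Set.range (algebraMap k _))) = ⊤ := by
    refine top_le_iff.mp (hgen.ge.trans (Subring.closure_mono ?_))
    rintro x (⟨o, rfl⟩ | hx)
    · refine Set.mem_union_left _ ?_
      rcases o with _ | _ | _ | o
      · simp
      · simp
      · simp
      · fin_cases o <;> simp
    · refine Set.mem_union_right _ ?_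
      rcases hx with hx | hx
      · rw [Set.mem_singleton_iff.mp hx]; exact Set.mem_union_left _ (by simp)
      · exact Set.mem_union_right _ hx
  have hsubh : cobordantAlgebra.subst k (fun o : Option (Option (Fin 4)) => Option.elim o 1 (fun o' => Option.elim o' 0 ![2, 0, 0, 0])) hQ = (∏ j : ZMod p, (X (some (some (some 2))) * X (some (some (some 1))) + C (j.val : k) * ((X none * X (some none) - X (some (some none)) * X (some (some (some 1)))) * (X none ^ 2 * X (some (some (some 0)))) * X (some (some none))))) ^ a * X (some (some (some 2))) ^ b := by
    rw [hhQ, map_mul, map_pow, map_pow, map_prod, hsub]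
    refine congrArg₂ (· ^ a * · ^ b) (Finset.prod_congr rfl fun j _ => ?_) ?_
    · rw [map_add, map_mul, map_mul, map_mul, map_mul, map_sub, map_mul, hsub, hsub, hsub, hsub, hsub, cobordantAlgebra.subst, MvPolynomial.eval₂Hom_C]
      simp only [Option.elim, Matrix.cons_val_zero, Matrix.cons_val_one, Matrix.cons_val, pow_zero, one_mul, pow_one]
    · simp only [Option.elim, Matrix.cons_val, pow_zero, one_mul]
  have hdvd_of : ∀ o : Option (Option (Option (Fin 4))), (o = some (some (some 0)) ∨ o = some (some (some 1)) ∨ o = some (some (some 2))) → IsUnit (algebraMap (MvPolynomial (Option (Option (Option (Fin 4)))) k) (Localization.Away (cobordantAlgebra.subst k (fun o : Option (Option (Fin 4)) => Option.elim o 1 (fun o' => Option.elim o' 0 ![2, 0, 0, 0])) hQ * X (some (some (some 0))) ^ (d * p * d₃))) (X o)) := by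
    intro o ho
    have hdv : (X o : MvPolynomial (Option (Option (Option (Fin 4)))) k) ∣
        cobordantAlgebra.subst k (fun o : Option (Option (Fin 4)) => Option.elim o 1 (fun o' => Option.elim o' 0 ![2, 0, 0, 0])) hQ * X (some (some (some 0))) ^ (d * p * d₃) := by
      rcases ho with rfl | rfl | rfl
      · exact Dvd.dvd.mul_left (dvd_pow_self _ (Nat.mul_pos hdp hd₃).ne') _
      · refine Dvd.dvd.mul_right ?_ _
        rw [hsubh]
        refine Dvd.dvd.mul_right (Dvd.dvd.trans ?_ (dvd_pow_self _ ha.ne')) _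
        have h0 := Finset.dvd_prod_of_mem (fun j : ZMod p => (X (some (some (some 2))) * X (some (some (some 1))) + C (j.val : k) * ((X none * X (some none) - X (some (some none)) * X (some (some (some 1)))) * (X none ^ 2 * X (some (some (some 0)))) * X (some (some none))) : MvPolynomial (Option (Option (Option (Fin 4)))) k)) (Finset.mem_univ (0 : ZMod p))
        simp only [ZMod.val_zero, Nat.cast_zero, C_0, zero_mul, add_zero] at h0
        exact Dvd.dvd.trans (Dvd.intro_left _ rfl) h0
      · refine Dvd.dvd.mul_right ?_ _
        rw [hsubh]
        exact Dvd.dvd.mul_left (dvd_pow_self _ hb.ne') _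
    exact isUnit_of_dvd_unit (map_dvd _ hdv) (IsLocalization.Away.algebraMap_isUnit (cobordantAlgebra.subst k (fun o : Option (Option (Fin 4)) => Option.elim o 1 (fun o' => Option.elim o' 0 ![2, 0, 0, 0])) hQ * X (some (some (some 0))) ^ (d * p * d₃)))
  have hY'u := hdvd_of (some (some (some 0))) (Or.inl rfl)
  have hX₁u := hdvd_of (some (some (some 1))) (Or.inr (Or.inl rfl))
  have hZu := hdvd_of (some (some (some 2))) (Or.inr (Or.inr rfl))
  have hc₀u : IsUnit c₀' := IsUnit.of_mul_eq_one κ' hcκ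
  have hκu : IsUnit κ' := IsUnit.of_mul_eq_one c₀' ((mul_comm _ _).trans hcκ)
  have hN'u : IsUnit N' := ((hNu.map (algebraMap (Localization.Away hQ) ↥(cobordantAlgebra (![Y, w] : Fin 2 → Localization.Away hQ) ![2, 1]))).map (algebraMap _ (ChartRing 𝒜Q (![Y, w] : Fin 2 → Localization.Away hQ) ![2, 1] (d₃ * (d * (2 * p))) y₀ hy₀))).map Φ₃
  -- a point of `V(s₃, W′, s)` with `h₃ ≠ 0`
  have hg₄ : ∀ i, (fun o : Option (Option (Option (Fin 4))) => if o = some (some (some 0)) ∨ o = some (some (some 1)) ∨ o = some (some (some 2)) then (1 : k) else 0)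
      ((![none, some none, some (some none)] : Fin 3 → Option (Option (Option (Fin 4)))) i) = 0 := by
    intro i; fin_cases i <;> exact if_neg (by decide)
  have hu₄ : MvPolynomial.eval (fun o : Option (Option (Option (Fin 4))) => if o = some (some (some 0)) ∨ o = some (some (some 1)) ∨ o = some (some (some 2)) then (1 : k) else 0)
      (cobordantAlgebra.subst k (fun o : Option (Option (Fin 4)) => Option.elim o 1 (fun o' => Option.elim o' 0 ![2, 0, 0, 0])) hQ * X (some (some (some 0))) ^ (d * p * d₃)) ≠ 0 := by
    rw [hsubh]
    simp
  haveI hchar₄ := charP_away_of_eval_ne_zero p _ _ hu₄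
  have hv₄ : Function.Injective (![none, some none, some (some none)] : Fin 3 → Option (Option (Option (Fin 4)))) := by
    intro i j hij; fin_cases i <;> fin_cases j <;> first | rfl | exact absurd hij (by decide)
  have hfv₄ : (fun i => algebraMap (MvPolynomial (Option (Option (Option (Fin 4)))) k) (Localization.Away (cobordantAlgebra.subst k (fun o : Option (Option (Fin 4)) => Option.elim o 1 (fun o' => Option.elim o' 0 ![2, 0, 0, 0])) hQ * X (some (some (some 0))) ^ (d * p * d₃))) (X ((![none, some none, some (some none)] : Fin 3 → Option (Option (Option (Fin 4)))) i))) = ![algebraMap (MvPolynomial (Option (Option (Option (Fin 4)))) k) _ (X none), algebraMap (MvPolynomial (Option (Option (Option (Fin 4)))) k) _ (X (some none)), algebraMap (MvPolynomial (Option (Option (Option (Fin 4)))) k) _ (X (some (some none)))] := by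
    funext i; fin_cases i <;> rfl
  have hK1₄ := isRegular_algebraMap_X_away k _ _ hv₄ _ hg₄ hu₄
  have hK1'₄ := isRegularRing_quotient_X_away k (cobordantAlgebra.subst k (fun o : Option (Option (Fin 4)) => Option.elim o 1 (fun o' => Option.elim o' 0 ![2, 0, 0, 0])) hQ * X (some (some (some 0))) ^ (d * p * d₃))
    (![none, some none, some (some none)] : Fin 3 → Option (Option (Option (Fin 4))))
  rw [hfv₄] at hK1₄ hK1'₄
  have hdA : algebraMap (MvPolynomial (Option (Option (Option (Fin 4)))) k) _ (X none) ∈ mapGrading (chartNodeGrading r 𝒜Q (![Y, w] : Fin 2 → Localization.Away hQ) ![2, 1] hf₃ (d₃ * (d * (2 * p))) y₀ hy₀) Φ₃ (consIndexEquiv r ((-1 : ℤ), 0)) := by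
    rw [← hΦS]
    exact map_algebraMap_mem_mapGrading r 𝒜Q _ ![2, 1] hf₃ _ y₀ hy₀ Φ₃ (s_mem_reesPiece 𝒜Q _ _)
  have hdB : algebraMap (MvPolynomial (Option (Option (Option (Fin 4)))) k) _ (X (some none)) ∈ mapGrading (chartNodeGrading r 𝒜Q (![Y, w] : Fin 2 → Localization.Away hQ) ![2, 1] hf₃ (d₃ * (d * (2 * p))) y₀ hy₀) Φ₃ (consIndexEquiv r ((1 : ℤ), 0)) := by
    rw [← hΦW']
    exact map_algebraMap_mem_mapGrading r 𝒜Q _ ![2, 1] hf₃ _ y₀ hy₀ Φ₃ (u'_mem_reesPiece 𝒜Q _ _ hf₃ 1)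
  have hdY' : algebraMap (MvPolynomial (Option (Option (Option (Fin 4)))) k) _ (X (some (some (some 0)))) ∈ mapGrading (chartNodeGrading r 𝒜Q (![Y, w] : Fin 2 → Localization.Away hQ) ![2, 1] hf₃ (d₃ * (d * (2 * p))) y₀ hy₀) Φ₃ (consIndexEquiv r ((2 : ℤ), θY)) := by
    rw [← hΦY']
    exact map_algebraMap_mem_mapGrading r 𝒜Q _ ![2, 1] hf₃ _ y₀ hy₀ Φ₃ (u'_mem_reesPiece 𝒜Q _ _ hf₃ 0)
  have hdQ : ∀ {x : Localization.Away hQ} {δ : Π j : Fin m, ZMod (r j)}, x ∈ 𝒜Q δ → Φ₃ (algebraMap ↥(cobordantAlgebra (![Y, w] : Fin 2 → Localization.Away hQ) ![2, 1]) (ChartRing 𝒜Q (![Y, w] : Fin 2 → Localization.Away hQ) ![2, 1] (d₃ * (d * (2 * p))) y₀ hy₀) (algebraMap (Localization.Away hQ) _ x)) ∈ mapGrading (chartNodeGrading r 𝒜Q (![Y, w] : Fin 2 → Localization.Away hQ) ![2, 1] hf₃ (d₃ * (d * (2 * p))) y₀ hy₀) Φ₃ (consIndexEquiv r ((0 : ℤ),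 δ)) := fun hx => map_algebraMap_mem_mapGrading r 𝒜Q _ ![2, 1] hf₃ _ y₀ hy₀ Φ₃ (algebraMap_mem_reesPiece 𝒜Q _ _ hx)
  have hdC : algebraMap (MvPolynomial (Option (Option (Option (Fin 4)))) k) _ (X (some (some none))) ∈ mapGrading (chartNodeGrading r 𝒜Q (![Y, w] : Fin 2 → Localization.Away hQ) ![2, 1] hf₃ (d₃ * (d * (2 * p))) y₀ hy₀) Φ₃ (consIndexEquiv r ((0 : ℤ), θs)) := by
    rw [← hΦs, ← hs]; exact hdQ dgs
  have hdt : t' ∈ mapGrading (chartNodeGrading r 𝒜Q (![Y, w] : Fin 2 → Localization.Away hQ) ![2, 1] hf₃ (d₃ * (d * (2 * p))) y₀ hy₀) Φ₃ (consIndexEquiv r ((0 : ℤ), θt)) := hdQ dgt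
  have hdc₀ : c₀' ∈ mapGrading (chartNodeGrading r 𝒜Q (![Y, w] : Fin 2 → Localization.Away hQ) ![2, 1] hf₃ (d₃ * (d * (2 * p))) y₀ hy₀) Φ₃ (consIndexEquiv r (((d₃ * (d * (2 * p)) : ℕ) : ℤ), 0)) := map_algebraMap_mem_mapGrading r 𝒜Q _ ![2, 1] hf₃ _ y₀ hy₀ Φ₃ (coverElement_mem_reesPiece 𝒜Q _ _ _ y₀ hy₀)
  have hdκ : κ' ∈ mapGrading (chartNodeGrading r 𝒜Q (![Y, w] : Fin 2 → Localization.Away hQ) ![2, 1] hf₃ (d₃ * (d * (2 * p))) y₀ hy₀) Φ₃ (consIndexEquiv r (-((d₃ * (d * (2 * p)) : ℕ) : ℤ), 0)) := map_invSelf_mem_mapGrading r 𝒜Q _ ![2, 1] hf₃ _ y₀ hy₀ Φ₃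
  -- the cover units `U₀ = c₀′²`, `U₁ = κ′²`, `U₂ = N′^{2dd₃}` make the raw cover elements of move 4 homogeneous of degree 0 (`e = 2dd₃`)
  have hb₀d : algebraMap (MvPolynomial (Option (Option (Option (Fin 4)))) k) _ (X none) ^ (2 * (2 * d * d₃ * p)) * c₀' ^ 2 ∈ mapGrading (chartNodeGrading r 𝒜Q (![Y, w] : Fin 2 → Localization.Away hQ) ![2, 1] hf₃ (d₃ * (d * (2 * p))) y₀ hy₀) Φ₃ 0 := by
    have h := SetLike.mul_mem_graded (SetLike.pow_mem_graded (2 * (2 * d * d₃ * p)) hdA) (SetLike.pow_mem_graded 2 hdc₀)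
    have e : (2 * (2 * d * d₃ * p)) • consIndexEquiv r ((-1 : ℤ), (0 : Π j : Fin m, ZMod (r j))) + 2 • consIndexEquiv r (((d₃ * (d * (2 * p)) : ℕ) : ℤ), (0 : Π j : Fin m, ZMod (r j))) = 0 := by
      rw [← map_nsmul, ← map_nsmul, ← map_add, ← (consIndexEquiv r).map_zero]
      congr 1
      refine Prod.ext ?_ ?_
      · simp only [Prod.fst_add, Prod.smul_fst, Prod.fst_zero]; push_cast; ring
      · simp only [Prod.snd_add, Prod.smul_snd, smul_zero, add_zero, Prod.snd_zero]
    rwa [e] at h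
  have hb₂d : algebraMap (MvPolynomial (Option (Option (Option (Fin 4)))) k) _ (X (some (some none))) ^ (2 * d * d₃ * p) * N' ^ (2 * d * d₃) ∈ mapGrading (chartNodeGrading r 𝒜Q (![Y, w] : Fin 2 → Localization.Away hQ) ![2, 1] hf₃ (d₃ * (d * (2 * p))) y₀ hy₀) Φ₃ 0 := by
    have h := hdQ dgN
    simp only [map_mul, map_pow] at h
    rw [hs, hΦs, ← hN'def, Prod.mk_zero_zero, map_zero] at h
    have h2 := SetLike.pow_mem_graded (2 * d * d₃) h
    rwa [smul_zero, mul_pow, ← pow_mul, show p * (2 * d * d₃) = 2 * d * d₃ * p by ring] at h2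
  have hδd : algebraMap (MvPolynomial (Option (Option (Option (Fin 4)))) k) _ (X (some (some none))) ^ 2 * t' * algebraMap (MvPolynomial (Option (Option (Option (Fin 4)))) k) _ (X (some (some (some 0)))) * algebraMap (MvPolynomial (Option (Option (Option (Fin 4)))) k) _ (X none) ∈ mapGrading (chartNodeGrading r 𝒜Q (![Y, w] : Fin 2 → Localization.Away hQ) ![2, 1] hf₃ (d₃ * (d * (2 * p))) y₀ hy₀) Φ₃ (consIndexEquiv r ((1 : ℤ), 0)) := by
    have h := SetLike.mul_mem_graded (SetLike.mul_mem_graded (SetLike.mul_mem_graded (SetLike.pow_mem_graded 2 hdC) hdt) hdY') hdA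
    have e : 2 • consIndexEquiv r ((0 : ℤ), θs) + consIndexEquiv r ((0 : ℤ), θt) + consIndexEquiv r ((2 : ℤ), θY) + consIndexEquiv r ((-1 : ℤ), (0 : Π j : Fin m, ZMod (r j))) = consIndexEquiv r ((1 : ℤ), 0) := by
      rw [← map_nsmul, ← map_add, ← map_add, ← map_add]
      congr 1
      refine Prod.ext ?_ ?_
      · simp only [Prod.fst_add, Prod.smul_fst]; norm_num
      · simp only [Prod.snd_add, Prod.smul_snd, add_zero]
        rw [← hR1]; abel
    rwa [e] at h
  have hb₁d : (∏ i : ZMod p, (algebraMap (MvPolynomial (Option (Option (Option (Fin 4)))) k) _ (X (some none)) + (i.val : _) * (algebraMap (MvPolynomial (Option (Option (Option (Fin 4)))) k) _ (X (some (some none))) ^ 2 * t' * algebraMap (MvPolynomial (Option (Option (Option (Fin 4)))) k) _ (X (some (some (some 0)))) * algebraMap (MvPolynomial (Option (Option (Option (Fin 4)))) k) _ (X none)))) ^ (2 * (2 * d * d₃)) * κ' ^ 2 ∈ mapGrading (chartNodeGrading r 𝒜Q (![Y, w] : Fin 2 → Localization.Away hQ) ![2, 1] hf₃ (d₃ * (d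 * (2 * p))) y₀ hy₀) Φ₃ 0 := by
    have hN := D4.d4m4_norm_deg t' _ _ _ _ (p := p) (mapGrading (chartNodeGrading r 𝒜Q (![Y, w] : Fin 2 → Localization.Away hQ) ![2, 1] hf₃ (d₃ * (d * (2 * p))) y₀ hy₀) Φ₃) _ hdB hδd
    have h := SetLike.mul_mem_graded (SetLike.pow_mem_graded (2 * (2 * d * d₃)) hN) (SetLike.pow_mem_graded 2 hdκ)
    have e : (2 * (2 * d * d₃)) • (p • consIndexEquiv r ((1 : ℤ), (0 : Π j : Fin m, ZMod (r j)))) + 2 • consIndexEquiv r (-(((d₃ * (d * (2 * p)) : ℕ) : ℤ)), (0 : Π j : Fin m, ZMod (r j))) = 0 := by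
      rw [← map_nsmul, ← map_nsmul, ← map_nsmul, ← map_add, ← (consIndexEquiv r).map_zero]
      congr 1
      refine Prod.ext ?_ ?_
      · simp only [Prod.fst_add, Prod.smul_fst, Prod.fst_zero]; push_cast; ring
      · simp only [Prod.snd_add, Prod.smul_snd, smul_zero, add_zero, Prod.snd_zero]
    rwa [e] at h
  have hJA : algebraMap (MvPolynomial (Option (Option (Option (Fin 4)))) k) (Localization.Away (cobordantAlgebra.subst k (fun o : Option (Option (Fin 4)) => Option.elim o 1 (fun o' => Option.elim o' 0 ![2, 0, 0, 0])) hQ * X (some (some (some 0))) ^ (d * p * d₃))) (X none) ∈ (weightedFiltration (![algebraMap (MvPolynomial (Option (Option (Option (Fin 4)))) k) _ (X none), algebraMap (MvPolynomial (Option (Option (Option (Fin 4)))) k) _ (X (some none)), algebraMap (MvPolynomial (Option (Option (Option (Fin 4)))) k) _ (X (some (some none)))] : Fin 3 → _) ![1, 1, 2]).ideal 1 := mem_weightedFiltration_ideal (![_, _, _] : Fin 3 → _) ![1, 1, 2] 0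
  have hJB : algebraMap (MvPolynomial (Option (Option (Option (Fin 4)))) k) (Localization.Away (cobordantAlgebra.subst k (fun o : Option (Option (Fin 4)) => Option.elim o 1 (fun o' => Option.elim o' 0 ![2, 0, 0, 0])) hQ * X (some (some (some 0))) ^ (d * p * d₃))) (X (some none)) ∈ (weightedFiltration (![algebraMap (MvPolynomial (Option (Option (Option (Fin 4)))) k) _ (X none), algebraMap (MvPolynomial (Option (Option (Option (Fin 4)))) k) _ (X (some none)), algebraMap (MvPolynomial (Option (Option (Option (Fin 4)))) k) _ (X (some (some none)))] : Fin 3 → _) ![1, 1, 2]).ideal 1 := mem_weightedFiltration_ideal (![_, _, _] : Fin 3 → _) ![1, 1, 2] 1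
  have hu₃val : Φ₃ ((E₃ u₃ : ↥(chartNodeGrading r 𝒜Q (![Y, w] : Fin 2 → Localization.Away hQ) ![2, 1] hf₃ (d₃ * (d * (2 * p))) y₀ hy₀ 0)) : ChartRing 𝒜Q (![Y, w] : Fin 2 → Localization.Away hQ) ![2, 1] (d₃ * (d * (2 * p))) y₀ hy₀) ∈ (weightedFiltration (![algebraMap (MvPolynomial (Option (Option (Option (Fin 4)))) k) _ (X none), algebraMap (MvPolynomial (Option (Option (Option (Fin 4)))) k) _ (X (some none)), algebraMap (MvPolynomial (Option (Option (Option (Fin 4)))) k) _ (X (some (some none)))] : Fin 3 → _) ![1, 1, 2]).ideal 1 := by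
    rw [hu₃v, map_mul, D4.d4m3_coverElement_one_eq t s Y w d d₃ c₁ hc₁]
    refine Ideal.mul_mem_right _ _ ?_
    simp only [map_pow]
    refine Ideal.pow_mem_of_mem _ ?_ _ (Nat.mul_pos (Nat.mul_pos two_pos hd) hd₃)
    simp only [map_prod]
    rw [← Finset.mul_prod_erase Finset.univ _ (Finset.mem_univ (0 : ZMod p))]
    refine Ideal.mul_mem_right _ _ ?_
    simp only [map_add, map_mul, hΦW', hΦS, hΦY']
    exact add_mem hJB (Ideal.mul_mem_left _ _ (Ideal.mul_mem_right _ _ hJA))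
  have huUval : ∀ i, Φ₃ ((E₃ (uU i) : ↥(chartNodeGrading r 𝒜Q (![Y, w] : Fin 2 → Localization.Away hQ) ![2, 1] hf₃ (d₃ * (d * (2 * p))) y₀ hy₀ 0)) : ChartRing 𝒜Q (![Y, w] : Fin 2 → Localization.Away hQ) ![2, 1] (d₃ * (d * (2 * p))) y₀ hy₀) ∈ (weightedFiltration (![algebraMap (MvPolynomial (Option (Option (Option (Fin 4)))) k) _ (X none), algebraMap (MvPolynomial (Option (Option (Option (Fin 4)))) k) _ (X (some none)), algebraMap (MvPolynomial (Option (Option (Option (Fin 4)))) k) _ (X (some (some none)))] : Fin 3 → _) ![1, 1, 2]).ideal 1 := by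
    intro i
    rw [huUv]
    obtain ⟨a, b, hab⟩ := Ideal.mem_span_pair.mp (by
      have h := D4.weightedFiltration_ideal_le_span (![Y, w] : Fin 2 → Localization.Away hQ) ![2, 1] le_rfl (hxU i)
      rwa [Matrix.range_cons, Matrix.range_cons, Matrix.range_empty, Set.union_empty, Set.union_singleton] at h)
    change Φ₃ (algebraMap ↥(cobordantAlgebra (![Y, w] : Fin 2 → Localization.Away hQ) ![2, 1]) (ChartRing 𝒜Q (![Y, w] : Fin 2 → Localization.Away hQ) ![2, 1] (d₃ * (d * (2 * p))) y₀ hy₀) (algebraMap (Localization.Away hQ) _ (xU i : Localization.Away hQ))) ∈ _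
    rw [← hab]
    simp only [map_add, map_mul]
    rw [hΦwv, hΦYv]
    exact add_mem (Ideal.mul_mem_left _ _ (Ideal.mul_mem_left _ _ hJB)) (Ideal.mul_mem_left _ _ (Ideal.mul_mem_right _ _ (Ideal.pow_mem_of_mem _ hJA _ two_pos)))
  obtain ⟨𝒦₄, d₄, -, hadm₄, hkill⟩ := d4_move4 hp hG M₃ W₃
    ({ affine := hW₃aff, m := m + 1, r := Fin.cons 0 r, B := ChartRing 𝒜Q (![Y, w] : Fin 2 → Localization.Away hQ) ![2, 1] (d₃ * (d * (2 * p))) y₀ hy₀, 𝒜 := chartNodeGrading r 𝒜Q (![Y, w] : Fin 2 → Localization.Away hQ) ![2, 1] hf₃ (d₃ * (d * (2 * p))) y₀ hy₀, σ := sigmaChart 𝒜Q (![Y, w] : Fin 2 → Localization.Away hQ) ![2, 1] (d₃ * (d * (2 * p))) y₀ hy₀ τQ hσJ₃ hp.pos hσpQ hσy₀, e := E₃, tame := htame₃, intertwine := hE₃ } : NodeData p M₃.act g₀ W₃)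
    Φ₃ (conj Φ₃ (sigmaChart 𝒜Q (![Y, w] : Fin 2 → Localization.Away hQ) ![2, 1] (d₃ * (d * (2 * p))) y₀ hy₀ τQ hσJ₃ hp.pos hσpQ hσy₀)) (fun _ => rfl)
    t' (algebraMap (MvPolynomial (Option (Option (Option (Fin 4)))) k) _ (X (some (some none)))) (algebraMap (MvPolynomial (Option (Option (Option (Fin 4)))) k) _ (X (some (some (some 0)))))
    (algebraMap (MvPolynomial (Option (Option (Option (Fin 4)))) k) _ (X (some (some (some 1))))) (algebraMap (MvPolynomial (Option (Option (Option (Fin 4)))) k) _ (X (some (some (some 2)))))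
    (algebraMap (MvPolynomial (Option (Option (Option (Fin 4)))) k) _ (X (some (some (some 3))))) (algebraMap (MvPolynomial (Option (Option (Option (Fin 4)))) k) _ (X (some none)))
    (algebraMap (MvPolynomial (Option (Option (Option (Fin 4)))) k) _ (X none)) (c₀' ^ 2) (κ' ^ 2) (N' ^ (2 * d * d₃)) _
    hσt hσs hσY' hσZ hσs₃ hσX₁ hσW' hσx₃ (by rw [map_pow, hσc₀]) (by rw [map_pow, hσκ]) (by rw [map_pow, hσN]) hfix hgen'
    hY'u hX₁u hZu (hc₀u.pow 2) (hκu.pow 2) (hN'u.pow _)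
    (consIndexEquiv r ((-1 : ℤ), 0)) (consIndexEquiv r ((1 : ℤ), 0)) (consIndexEquiv r ((0 : ℤ), θs)) (2 * d * d₃) (Nat.mul_pos (Nat.mul_pos two_pos hd) hd₃)
    hdA hdB hdC hb₀d hb₁d hb₂d hK1₄ hK1'₄
    (fun o : Option ι => Option.elim o W₃' U) (fun x => by
      rcases hcov x with h | h | ⟨i, h⟩
      · exact Or.inl h
      · exact Or.inr ⟨none, h⟩
      · exact Or.inr ⟨some i, h⟩)
    (fun o : Option ι => Option.elim o u₃ uU) (fun _ => 1) (fun _ => one_pos)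
    (fun o => by rcases o with _ | i; exacts [hu₃val, huUval i])
    (fun o => by rcases o with _ | i; exacts [hu₃U, huUU i]) 𝔄₃ hF₃
  refine ⟨𝒦₄, d₄, hadm₄, fun M₄ hm₄ => ⟨⟨NodeAtlasData.ofNodeAtlas (p := p) (ρ := M₄.act) (g₀ := g₀) M₄.atlas⟩, ?_⟩⟩
  obtain ⟨π₄, hbl₄, -, hr₄, hcomm₄⟩ := hm₄
  exact hkill M₄ π₄ hbl₄ hr₄ hcomm₄

end Summit.ResolutionOfSingularities.ResolutionOfSingularities.Theorems.WildQuotientResolution.S1.GameFrame.GModel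

end
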